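import Literature.MeasureTheory.Lebesgue.TriangularShearSubstitution
import Literature.Barriers.AtomisticToContinuum.HardDiskGibbsKernel
import HarnessLib

/-!
# From a hard-core preserving deformation to the finite-volume inequality (5.8):
# the kernel computation of Richthammer 2007, §5.5/§6.6, for abstract cell data

Part of the bottom-up programme for `Richthammer2007_ineq35` via the named fact
`Richthammer2007_ineq58` (`HardDiskTranslationInvarianceFinalSteps.lean`), whose `∀ X̄`-clause is
the inequality between finite-volume hard-disc weights
`W_Λ(D ∩ G | X̄) ≤ W_Λ(D - τe | X̄) + W_Λ(D + τe | X̄)`. In the paper it results from the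
computation of §5.5 (displays before (5.8)) whose analytic core is §6.6: for every particle
number `k` the box `Λ^k` is cut into the cells `A_π^k` of a fixed selection order `π`, on which
the generalised translation `𝔗_n` acts on the thrown points as the "formal transformation"
`T_π` (6.21) — a triangular system of `1/2`-Lipschitz shears along `e₁` — with
`x ∈ A_π ⇔ T_π(x) ∈ Ã_π` (6.22), and the Lebesgue transformation theorem is applied coordinate
by coordinate; the backwards translation `𝔗̄_n` is the same with `e₁ ↦ -e₁` (same translation
distances, §5.4), and on good configurations `φ̄_n + φ_n ≥ 1` (AM–GM and Lemma 12), points stay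
in `Λ_n` and inner points move by exactly `±τe₁` (Lemma 9, so `𝔗_n(D ∩ G_n) ⊆ D + τe₁`), and the
hard core is preserved ((5.4)–(5.5), Lemma 8).

This file isolates that computation from the construction: `ShearCells k` is abstract cell
data on `(ℝ²)^k` (source cells `A_c`, target cells `Ã⁺_c`, `Ã⁻_c`, a translation system `t_c`
and a selection order `π_c` per cell), `ShearCells.Admissible` lists exactly the properties the
construction of §5.4 has to deliver (Lemmas 8–10, 12, (6.21)–(6.22), in coordinates, for one
boundary condition `X̄` and one volume `Λ`), and
`weight_le_add_of_shearCells` PROVES the weight inequality from them, using the iterated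
substitution rule `lintegral_shearJacobian_mul_comp_shearMap_of_perm`
(`Literature/MeasureTheory/Lebesgue/TriangularShearSubstitution.lean`) with the measurable
Jacobian `shearJacobian` (`∏ (1 + ∂₁ᵉ t)`, `= φ_n` a.e.).

## References

* [Richthammer2007] T. Richthammer, *Translation-invariance of two-dimensional Gibbsian point
  processes*, Comm. Math. Phys. 274 (2007) 81–122, arXiv:0706.3637: §5.4 (5.4)–(5.7), Lemmas
  8–11 (p. 11), §5.5 (5.8), Lemma 12 (p. 12), §6.6 (6.21)–(6.22) (p. 16), §6.7 (p. 17).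
-/

noncomputable section

open MeasureTheory Set Function
open scoped ENNReal NNReal

namespace Literature.Barriers.AtomisticToContinuum.HardDisk

open Literature.Analysis.FunctionSpaces Literature.MeasureTheory.Lebesgue

/-! ### Abstract cell data -/

/-- **Cell data for the change of variables with `k` thrown points** (Richthammer 2007, §6.6):
a finite index type of cells (`Π`, the selection orders), for each cell `c` a source cell
`A_c ⊆ (ℝ²)^k` (the points whose selection order is `c`, `A_π^k`), target cells `Ã⁺_c`, `Ã⁻_c`
for the forward and backward deformation (`Ã_π^k`), the translation system `t_c`
(`t^{π(j)}_{π,x}`, the translation of particle `j` as a function of all particles) and the order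
`π_c` in which it is triangular. [cite: Richthammer2007, §6.6 (p. 16)] -/
structure ShearCells (k : ℕ) where
  /-- The cells (selection orders). -/
  ι : Type
  /-- There are finitely many cells. -/
  [instFintype : Fintype ι]
  /-- The source cell `A_c`. -/
  source : ι → Set (Fin k → EuclideanSpace ℝ (Fin 2))
  /-- The target cell of the forward deformation. -/
  targetPos : ι → Set (Fin k → EuclideanSpace ℝ (Fin 2))
  /-- The target cell of the backward deformation. -/
  targetNeg : ι → Set (Fin k → EuclideanSpace ℝ (Fin 2))
  /-- The translation system of the cell: particle `j` moves by `t_c j x` along `±e₁`. -/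
  shift : ι → Fin k → (Fin k → EuclideanSpace ℝ (Fin 2)) → ℝ
  /-- The selection order in which `t_c` is triangular (`π_c 0` is selected last). -/
  order : ι → Equiv.Perm (Fin k)

attribute [instance] ShearCells.instFintype

/-- **What the construction must deliver, cell by cell, for one boundary condition `X̄` and
one volume `Λ`** (source event `S = D ∩ G_n`, target events `D₊ = D + τe₁`, `D₋ = D - τe₁`):
measurability; triangularity and the `L`-Lipschitz property along `e₁` of the translation
systems (Lemma 16 / (6.2)); measurable, pairwise disjoint target cells (the cells of the inverse
construction, §6.5); the TRANSFER property — a point of `A_c` in `Λ^k` whose configuration lies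
in `S` and satisfies the hard core is mapped into `Ã^±_c`, stays in `Λ^k`, its configuration
lands in `D±` and keeps the hard core ((6.21), (6.22), Lemma 9 / (5.7), Lemma 8 / (5.4)–(5.5));
the source cells cover almost every relevant point (every injective `x` has a selection order);
and `φ̄ + φ ≥ 1` (Lemma 12 with the arithmetic-geometric mean inequality).
[cite: Richthammer2007, §5.4–5.5 (pp. 11–12) and §6.5–6.7 (pp. 14–17)] -/
structure ShearCells.Admissible {k : ℕ} (C : ShearCells k) (L : ℝ≥0)
    (Λ : Set (EuclideanSpace ℝ (Fin 2))) (Y : PointConfig (EuclideanSpace ℝ (Fin 2)))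
    (S Dpos Dneg : Set (PointConfig (EuclideanSpace ℝ (Fin 2)))) : Prop where
  /-- The translation systems are measurable. -/
  measurable_shift : ∀ c j, Measurable (C.shift c j)
  /-- The translation systems are triangular in the order `π_c`. -/
  triangular : ∀ c j x x', (∀ i, j ≤ i → x (C.order c i) = x' (C.order c i)) →
    C.shift c (C.order c j) x = C.shift c (C.order c j) x'
  /-- The translation systems are `L`-Lipschitz along `e₁` in each particle. -/
  lipschitz : ∀ c j x, LipschitzWith L fun r : ℝ =>
    C.shift c j (update x j (x j + r • EuclideanSpace.single 0 (1 : ℝ)))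
  /-- Source cells are measurable. -/
  measurableSet_source : ∀ c, MeasurableSet (C.source c)
  /-- Forward target cells are measurable. -/
  measurableSet_targetPos : ∀ c, MeasurableSet (C.targetPos c)
  /-- Backward target cells are measurable. -/
  measurableSet_targetNeg : ∀ c, MeasurableSet (C.targetNeg c)
  /-- Forward target cells are pairwise disjoint. -/
  disjoint_targetPos : Pairwise (Disjoint on C.targetPos)
  /-- Backward target cells are pairwise disjoint. -/
  disjoint_targetNeg : Pairwise (Disjoint on C.targetNeg)
  /-- Transfer property of the forward deformation. -/
  transfer_pos : ∀ c x, x ∈ C.source c → (∀ j, x j ∈ Λ) → superpose Λ x Y ∈ S →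
    HardCoreIn Λ (superpose Λ x Y) →
      shearMap (C.shift c) x ∈ C.targetPos c ∧ (∀ j, shearMap (C.shift c) x j ∈ Λ) ∧
        superpose Λ (shearMap (C.shift c) x) Y ∈ Dpos ∧
          HardCoreIn Λ (superpose Λ (shearMap (C.shift c) x) Y)
  /-- Transfer property of the backward deformation (same translation distances, direction `-e₁`). -/
  transfer_neg : ∀ c x, x ∈ C.source c → (∀ j, x j ∈ Λ) → superpose Λ x Y ∈ S →
    HardCoreIn Λ (superpose Λ x Y) →
      shearMap (fun j x => -C.shift c j x) x ∈ C.targetNeg c ∧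
        (∀ j, shearMap (fun j x => -C.shift c j x) x j ∈ Λ) ∧
          superpose Λ (shearMap (fun j x => -C.shift c j x) x) Y ∈ Dneg ∧
            HardCoreIn Λ (superpose Λ (shearMap (fun j x => -C.shift c j x) x) Y)
  /-- Almost every relevant point lies in some source cell. -/
  cover : ∀ᵐ x ∂(Measure.pi fun _ : Fin k =>
      (volume : Measure (EuclideanSpace ℝ (Fin 2))).restrict Λ),
    superpose Λ x Y ∈ S → HardCoreIn Λ (superpose Λ x Y) → ∃ c, x ∈ C.source c
  /-- `φ̄ + φ ≥ 1` on the source cells. -/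
  jacobian : ∀ c x, x ∈ C.source c → (∀ j, x j ∈ Λ) → superpose Λ x Y ∈ S →
    HardCoreIn Λ (superpose Λ x Y) →
      1 ≤ shearJacobian (C.shift c) x + shearJacobian (fun j x => -C.shift c j x) x

/-! ### Elementary lemmas -/

/-- Pairwise disjoint sets: at most one indicator is `1`. [folklore] -/
theorem sum_indicator_one_le_one {α ι : Type*} [Fintype ι] {A : ι → Set α}
    (h : Pairwise (Disjoint on A)) (x : α) :
    ∑ c, (A c).indicator (1 : α → ℝ≥0∞) x ≤ 1 := by
  classical
  by_cases hx : ∃ c, x ∈ A c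
  · obtain ⟨c, hc⟩ := hx
    rw [Finset.sum_eq_single c]
    · rw [indicator_of_mem hc]; exact le_rfl
    · intro c' _ hc'
      rw [indicator_of_notMem]
      exact fun hx' => Set.disjoint_left.1 (h hc') hx' hc
    · intro h'; exact absurd (Finset.mem_univ c) h'
  · push Not at hx
    simp [indicator_of_notMem (hx _)]

/-- Negation preserves Lipschitz constants. [folklore] -/
theorem LipschitzWith.fun_neg_real {K : ℝ≥0} {f : ℝ → ℝ} (h : LipschitzWith K f) :
    LipschitzWith K fun r => -f r :=
  LipschitzWith.of_dist_le_mul fun a b => by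
    rw [dist_neg_neg]; exact h.dist_le_mul a b

/-- The box `Λ^k` as a measurable subset of `(ℝ²)^k`. [folklore] -/
theorem measurableSet_piBox {Λ : Set (EuclideanSpace ℝ (Fin 2))} (hΛ : MeasurableSet Λ) (k : ℕ) :
    MeasurableSet (Set.univ.pi fun _ : Fin k => Λ) :=
  MeasurableSet.univ_pi fun _ => hΛ

/-- `λ_Λ^{⊗k}` is `λ^{⊗k}` restricted to `Λ^k`. [folklore] -/
theorem pi_restrict_eq (Λ : Set (EuclideanSpace ℝ (Fin 2))) (k : ℕ) :
    (Measure.pi fun _ : Fin k => (volume : Measure (EuclideanSpace ℝ (Fin 2))).restrict Λ) =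
      (Measure.pi fun _ : Fin k => (volume : Measure (EuclideanSpace ℝ (Fin 2)))).restrict
        (Set.univ.pi fun _ : Fin k => Λ) :=
  (Measure.restrict_pi_pi _ _).symm

/-! ### One direction, one particle number -/

/-- **The cell-wise transport inequality** (one deformation direction, `k` thrown points): if
every source cell is transferred into its target cell with points kept in `Λ`, configurations
sent from `S` into `D` and hard core preserved, and the target cells are pairwise disjoint, then
`∫_{Λ^k} 1_{S ∩ hc}(X_x) ∑_c 1_{A_c}(x) J_c(x) dx ≤ ∫_{Λ^k} 1_{D ∩ hc}(X_{x'}) dx'`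
(`J_c = shearJacobian t_c`; cell by cell: the pointwise transfer, the substitution rule
`∫ J_c u(T_c x) dx = ∫ u`, and `∑_c 1_{Ã_c} ≤ 1`). [cite: Richthammer2007, §5.5 and §6.6 (pp. 12, 16)] -/
theorem lintegral_indicator_mul_sum_le {k : ℕ} {L : ℝ≥0} (hL : L < 1)
    {Λ : Set (EuclideanSpace ℝ (Fin 2))} (hΛ : MeasurableSet Λ)
    (Y : PointConfig (EuclideanSpace ℝ (Fin 2)))
    {S D : Set (PointConfig (EuclideanSpace ℝ (Fin 2)))} (hS : MeasurableSet S) (hD : MeasurableSet D)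
    {ι : Type*} [Fintype ι] (A B : ι → Set (Fin k → EuclideanSpace ℝ (Fin 2)))
    (t : ι → Fin k → (Fin k → EuclideanSpace ℝ (Fin 2)) → ℝ) (π : ι → Equiv.Perm (Fin k))
    (hm : ∀ c j, Measurable (t c j))
    (htri : ∀ c j x x', (∀ i, j ≤ i → x (π c i) = x' (π c i)) → t c (π c j) x = t c (π c j) x')
    (hlip : ∀ c j x, LipschitzWith L fun r : ℝ =>
      t c j (update x j (x j + r • EuclideanSpace.single 0 (1 : ℝ))))
    (hA : ∀ c, MeasurableSet (A c)) (hB : ∀ c, MeasurableSet (B c))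
    (hdisj : Pairwise (Disjoint on B))
    (htrans : ∀ c x, x ∈ A c → (∀ j, x j ∈ Λ) → superpose Λ x Y ∈ S →
      HardCoreIn Λ (superpose Λ x Y) →
        shearMap (t c) x ∈ B c ∧ (∀ j, shearMap (t c) x j ∈ Λ) ∧
          superpose Λ (shearMap (t c) x) Y ∈ D ∧ HardCoreIn Λ (superpose Λ (shearMap (t c) x) Y)) :
    ∫⁻ x, (S ∩ {X | HardCoreIn Λ X}).indicator 1 (superpose Λ x Y) *
          ∑ c, (A c).indicator 1 x * shearJacobian (t c) x
        ∂(Measure.pi fun _ : Fin k => (volume : Measure (EuclideanSpace ℝ (Fin 2))).restrict Λ) ≤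
      ∫⁻ x, (D ∩ {X | HardCoreIn Λ X}).indicator 1 (superpose Λ x Y)
        ∂(Measure.pi fun _ : Fin k => (volume : Measure (EuclideanSpace ℝ (Fin 2))).restrict Λ) := by
  classical
  set P : Set (Fin k → EuclideanSpace ℝ (Fin 2)) := Set.univ.pi fun _ : Fin k => Λ with hP
  have hPm : MeasurableSet P := measurableSet_piBox hΛ k
  have hmemP : ∀ x : Fin k → EuclideanSpace ℝ (Fin 2), x ∈ P ↔ ∀ j, x j ∈ Λ := fun x => by
    simp [hP]
  -- the relevant preimages
  have hpreS : MeasurableSet {x : Fin k → EuclideanSpace ℝ (Fin 2) |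
      superpose Λ x Y ∈ S ∩ {X | HardCoreIn Λ X}} :=
    (measurable_superpose_left hΛ k Y) (hS.inter (measurableSet_hardCoreIn hΛ))
  have hpreD : MeasurableSet {x : Fin k → EuclideanSpace ℝ (Fin 2) |
      superpose Λ x Y ∈ D ∩ {X | HardCoreIn Λ X}} :=
    (measurable_superpose_left hΛ k Y) (hD.inter (measurableSet_hardCoreIn hΛ))
  -- source and target integrands of a cell
  set F : ι → (Fin k → EuclideanSpace ℝ (Fin 2)) → ℝ≥0∞ := fun c =>
    (P ∩ A c ∩ {x | superpose Λ x Y ∈ S ∩ {X | HardCoreIn Λ X}}).indicator (shearJacobian (t c))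
    with hF
  set u : ι → (Fin k → EuclideanSpace ℝ (Fin 2)) → ℝ≥0∞ := fun c =>
    (P ∩ B c ∩ {x | superpose Λ x Y ∈ D ∩ {X | HardCoreIn Λ X}}).indicator 1 with hu
  have hFm : ∀ c, Measurable (F c) := fun c =>
    (measurable_shearJacobian (hm c)).indicator ((hPm.inter (hA c)).inter hpreS)
  have hum : ∀ c, Measurable (u c) := fun c =>
    measurable_one.indicator ((hPm.inter (hB c)).inter hpreD)
  -- pointwise transfer: `F_c ≤ J_c · u_c ∘ T_c`
  have hpt : ∀ c x, F c x ≤ shearJacobian (t c) x * u c (shearMap (t c) x) := by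
    intro c x
    by_cases hx : x ∈ P ∩ A c ∩ {x | superpose Λ x Y ∈ S ∩ {X | HardCoreIn Λ X}}
    · obtain ⟨⟨hxP, hxA⟩, hxS, hxH⟩ := hx
      obtain ⟨h1, h2, h3, h4⟩ := htrans c x hxA ((hmemP x).1 hxP) hxS hxH
      have hmem : x ∈ P ∩ A c ∩ {x | superpose Λ x Y ∈ S ∩ {X | HardCoreIn Λ X}} :=
        ⟨⟨hxP, hxA⟩, hxS, hxH⟩
      have hmem' : shearMap (t c) x ∈ P ∩ B c ∩ {x | superpose Λ x Y ∈ D ∩ {X | HardCoreIn Λ X}} :=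
        ⟨⟨(hmemP _).2 h2, h1⟩, h3, h4⟩
      rw [hF]; simp only []
      rw [indicator_of_mem hmem, hu]
      simp only []
      rw [indicator_of_mem hmem', Pi.one_apply, mul_one]
    · rw [hF]; simp only []
      rw [indicator_of_notMem hx]
      exact bot_le
  -- rewrite the two integrals over `λ^{⊗k}` with the indicator of `Λ^k`
  rw [pi_restrict_eq, ← lintegral_indicator hPm, ← lintegral_indicator hPm]
  -- the left integrand is `∑_c F_c`
  have hleft : ∀ x, P.indicator (fun x => (S ∩ {X | HardCoreIn Λ X}).indicator 1 (superpose Λ x Y) *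
      ∑ c, (A c).indicator 1 x * shearJacobian (t c) x) x = ∑ c, F c x := by
    intro x
    by_cases hxP : x ∈ P
    · rw [indicator_of_mem hxP, Finset.mul_sum]
      refine Finset.sum_congr rfl fun c _ => ?_
      rw [hF]; simp only []
      by_cases hxS : superpose Λ x Y ∈ S ∩ {X | HardCoreIn Λ X}
      · rw [indicator_of_mem hxS, Pi.one_apply, one_mul]
        by_cases hxA : x ∈ A c
        · have hmem : x ∈ P ∩ A c ∩ {x | superpose Λ x Y ∈ S ∩ {X | HardCoreIn Λ X}} :=
            ⟨⟨hxP, hxA⟩, hxS⟩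
          rw [indicator_of_mem hxA, indicator_of_mem hmem, Pi.one_apply, one_mul]
        · rw [indicator_of_notMem hxA, indicator_of_notMem (fun h => hxA h.1.2), zero_mul]
      · rw [indicator_of_notMem hxS, zero_mul, indicator_of_notMem (fun h => hxS h.2)]
    · rw [indicator_of_notMem hxP]
      symm
      refine Finset.sum_eq_zero fun c _ => ?_
      rw [hF]; simp only []
      rw [indicator_of_notMem (fun h => hxP h.1.1)]
  -- the right integrand dominates `∑_c u_c`
  have hright : ∀ x, ∑ c, u c x ≤
      P.indicator (fun x => (D ∩ {X | HardCoreIn Λ X}).indicator 1 (superpose Λ x Y)) x := by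
    intro x
    by_cases hxP : x ∈ P
    · rw [indicator_of_mem hxP]
      by_cases hxD : superpose Λ x Y ∈ D ∩ {X | HardCoreIn Λ X}
      · rw [indicator_of_mem hxD, Pi.one_apply]
        calc ∑ c, u c x = ∑ c, (B c).indicator (1 : (Fin k → EuclideanSpace ℝ (Fin 2)) → ℝ≥0∞) x := by
              refine Finset.sum_congr rfl fun c _ => ?_
              rw [hu]; simp only []
              by_cases hxB : x ∈ B c
              · have hmem : x ∈ P ∩ B c ∩ {x | superpose Λ x Y ∈ D ∩ {X | HardCoreIn Λ X}} :=
                  ⟨⟨hxP, hxB⟩, hxD⟩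
                rw [indicator_of_mem hxB, indicator_of_mem hmem]
              · rw [indicator_of_notMem hxB, indicator_of_notMem (fun h => hxB h.1.2)]
          _ ≤ 1 := sum_indicator_one_le_one hdisj x
      · rw [indicator_of_notMem hxD]
        refine le_of_eq (Finset.sum_eq_zero fun c _ => ?_)
        rw [hu]; simp only []
        rw [indicator_of_notMem (fun h => hxD h.2)]
    · rw [indicator_of_notMem hxP]
      refine le_of_eq (Finset.sum_eq_zero fun c _ => ?_)
      rw [hu]; simp only []
      rw [indicator_of_notMem (fun h => hxP h.1.1)]
  -- assemble
  calc ∫⁻ x, P.indicator (fun x => (S ∩ {X | HardCoreIn Λ X}).indicator 1 (superpose Λ x Y) *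
          ∑ c, (A c).indicator 1 x * shearJacobian (t c) x) x
          ∂(Measure.pi fun _ : Fin k => (volume : Measure (EuclideanSpace ℝ (Fin 2))))
      = ∑ c, ∫⁻ x, F c x ∂(Measure.pi fun _ : Fin k => (volume : Measure (EuclideanSpace ℝ (Fin 2)))) := by
        rw [← lintegral_finsetSum _ fun c _ => hFm c]
        exact lintegral_congr hleft
    _ ≤ ∑ c, ∫⁻ x, shearJacobian (t c) x * u c (shearMap (t c) x)
          ∂(Measure.pi fun _ : Fin k => (volume : Measure (EuclideanSpace ℝ (Fin 2)))) :=
        Finset.sum_le_sum fun c _ => lintegral_mono (hpt c)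
    _ = ∑ c, ∫⁻ x, u c x ∂(Measure.pi fun _ : Fin k => (volume : Measure (EuclideanSpace ℝ (Fin 2)))) :=
        Finset.sum_congr rfl fun c _ =>
          lintegral_shearJacobian_mul_comp_shearMap_of_perm hL (π c) (hm c) (htri c) (hlip c) (hum c)
    _ = ∫⁻ x, ∑ c, u c x ∂(Measure.pi fun _ : Fin k => (volume : Measure (EuclideanSpace ℝ (Fin 2)))) :=
        (lintegral_finsetSum _ fun c _ => hum c).symm
    _ ≤ ∫⁻ x, P.indicator (fun x => (D ∩ {X | HardCoreIn Λ X}).indicator 1 (superpose Λ x Y)) x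
          ∂(Measure.pi fun _ : Fin k => (volume : Measure (EuclideanSpace ℝ (Fin 2)))) :=
        lintegral_mono hright

/-! ### Both directions, all particle numbers: the weight inequality -/

/-- The `k`-point integrand is dominated, almost everywhere, by its product with
`∑_c 1_{A_c} (J⁺_c + J⁻_c) ≥ 1` (cover and `φ̄ + φ ≥ 1`). [cite: Richthammer2007, §5.5 Lemma 12 (p. 12)] -/
theorem indicator_le_mul_sum_ae {k : ℕ} {C : ShearCells k} {L : ℝ≥0}
    {Λ : Set (EuclideanSpace ℝ (Fin 2))} (hΛ : MeasurableSet Λ)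
    {Y : PointConfig (EuclideanSpace ℝ (Fin 2))}
    {S Dpos Dneg : Set (PointConfig (EuclideanSpace ℝ (Fin 2)))}
    (hC : C.Admissible L Λ Y S Dpos Dneg) :
    ∀ᵐ x ∂(Measure.pi fun _ : Fin k => (volume : Measure (EuclideanSpace ℝ (Fin 2))).restrict Λ),
      (S ∩ {X | HardCoreIn Λ X}).indicator (1 : PointConfig (EuclideanSpace ℝ (Fin 2)) → ℝ≥0∞)
          (superpose Λ x Y) ≤
        (S ∩ {X | HardCoreIn Λ X}).indicator 1 (superpose Λ x Y) *
          ∑ c, (C.source c).indicator 1 x *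
            (shearJacobian (C.shift c) x + shearJacobian (fun j x => -C.shift c j x) x) := by
  classical
  have hbox : ∀ᵐ x ∂(Measure.pi fun _ : Fin k =>
      (volume : Measure (EuclideanSpace ℝ (Fin 2))).restrict Λ), ∀ j, x j ∈ Λ := by
    rw [pi_restrict_eq]
    filter_upwards [ae_restrict_mem (measurableSet_piBox hΛ k)] with x hx
    simpa [Set.mem_univ_pi] using hx
  filter_upwards [hC.cover, hbox] with x hcov hxΛ
  by_cases hxS : superpose Λ x Y ∈ S ∩ {X | HardCoreIn Λ X}
  · obtain ⟨c, hc⟩ := hcov hxS.1 hxS.2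
    rw [indicator_of_mem hxS, Pi.one_apply, one_mul]
    calc (1 : ℝ≥0∞) ≤ shearJacobian (C.shift c) x + shearJacobian (fun j x => -C.shift c j x) x :=
          hC.jacobian c x hc hxΛ hxS.1 hxS.2
      _ = (C.source c).indicator 1 x *
            (shearJacobian (C.shift c) x + shearJacobian (fun j x => -C.shift c j x) x) := by
          rw [indicator_of_mem hc, Pi.one_apply, one_mul]
      _ ≤ ∑ c, (C.source c).indicator 1 x *
            (shearJacobian (C.shift c) x + shearJacobian (fun j x => -C.shift c j x) x) :=
          Finset.single_le_sum (f := fun c => (C.source c).indicator 1 x *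
            (shearJacobian (C.shift c) x + shearJacobian (fun j x => -C.shift c j x) x))
            (fun c _ => bot_le) (Finset.mem_univ c)
  · rw [indicator_of_notMem hxS]
    exact bot_le

/-- **The finite-volume inequality from admissible cell data** (Richthammer 2007, §5.5: the
kernel-level content of (5.8) together with the inclusions `𝔗(D ∩ G) ⊆ D + τe`,
`𝔗̄(D ∩ G) ⊆ D - τe`). If for every number `k` of thrown points there are admissible cells for
the volume `Λ`, boundary condition `X̄`, source event `S` and target events `D₊`, `D₋`, then
`W_Λ(S | X̄) ≤ W_Λ(D₊ | X̄) + W_Λ(D₋ | X̄)` for the hard-disc weights `weight z Λ X̄`.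
[cite: Richthammer2007, §5.5 (5.8) (p. 12) with §6.6 (p. 16)] -/
theorem weight_le_add_of_shearCells (z : ℝ) {L : ℝ≥0} (hL : L < 1)
    {Λ : Set (EuclideanSpace ℝ (Fin 2))} (hΛ : MeasurableSet Λ)
    (Y : PointConfig (EuclideanSpace ℝ (Fin 2)))
    {S Dpos Dneg : Set (PointConfig (EuclideanSpace ℝ (Fin 2)))}
    (hS : MeasurableSet S) (hDpos : MeasurableSet Dpos) (hDneg : MeasurableSet Dneg)
    (C : ∀ k, ShearCells k) (hC : ∀ k, (C k).Admissible L Λ Y S Dpos Dneg) :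
    weight z Λ Y S ≤ weight z Λ Y Dpos + weight z Λ Y Dneg := by
  classical
  unfold weight
  rw [← ENNReal.tsum_add]
  refine ENNReal.tsum_le_tsum fun k => ?_
  rw [← mul_add]
  refine mul_le_mul' le_rfl ?_
  -- the `k`-point integrals
  set J : (C k).ι → (Fin k → EuclideanSpace ℝ (Fin 2)) → ℝ≥0∞ := fun c x =>
    (C k |>.source c).indicator 1 x * shearJacobian ((C k).shift c) x with hJ
  set J' : (C k).ι → (Fin k → EuclideanSpace ℝ (Fin 2)) → ℝ≥0∞ := fun c x =>
    (C k |>.source c).indicator 1 x * shearJacobian (fun j x => -(C k).shift c j x) x with hJ'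
  have hJm : ∀ c, Measurable (J c) := fun c =>
    (measurable_one.indicator ((hC k).measurableSet_source c)).mul
      (measurable_shearJacobian ((hC k).measurable_shift c))
  have hJ'm : ∀ c, Measurable (J' c) := fun c =>
    (measurable_one.indicator ((hC k).measurableSet_source c)).mul
      (measurable_shearJacobian fun j => ((hC k).measurable_shift c j).neg)
  have hind : Measurable fun x : Fin k → EuclideanSpace ℝ (Fin 2) =>
      (S ∩ {X | HardCoreIn Λ X}).indicator (1 : PointConfig (EuclideanSpace ℝ (Fin 2)) → ℝ≥0∞)
        (superpose Λ x Y) :=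
    measurable_weightIntegrand_left hΛ hS k Y
  calc ∫⁻ x, (S ∩ {X | HardCoreIn Λ X}).indicator 1 (superpose Λ x Y)
          ∂(Measure.pi fun _ : Fin k => (volume : Measure (EuclideanSpace ℝ (Fin 2))).restrict Λ)
      ≤ ∫⁻ x, (S ∩ {X | HardCoreIn Λ X}).indicator 1 (superpose Λ x Y) *
          ∑ c, ((C k).source c).indicator 1 x *
            (shearJacobian ((C k).shift c) x + shearJacobian (fun j x => -(C k).shift c j x) x)
          ∂(Measure.pi fun _ : Fin k => (volume : Measure (EuclideanSpace ℝ (Fin 2))).restrict Λ) :=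
        lintegral_mono_ae (indicator_le_mul_sum_ae hΛ (hC k))
    _ = ∫⁻ x, ((S ∩ {X | HardCoreIn Λ X}).indicator 1 (superpose Λ x Y) * ∑ c, J c x +
          (S ∩ {X | HardCoreIn Λ X}).indicator 1 (superpose Λ x Y) * ∑ c, J' c x)
          ∂(Measure.pi fun _ : Fin k => (volume : Measure (EuclideanSpace ℝ (Fin 2))).restrict Λ) := by
        refine lintegral_congr fun x => ?_
        rw [← mul_add, ← Finset.sum_add_distrib]
        congr 1
        exact Finset.sum_congr rfl fun c _ => by rw [hJ, hJ']; simp only []; rw [mul_add]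
    _ = ∫⁻ x, (S ∩ {X | HardCoreIn Λ X}).indicator 1 (superpose Λ x Y) * ∑ c, J c x
          ∂(Measure.pi fun _ : Fin k => (volume : Measure (EuclideanSpace ℝ (Fin 2))).restrict Λ) +
        ∫⁻ x, (S ∩ {X | HardCoreIn Λ X}).indicator 1 (superpose Λ x Y) * ∑ c, J' c x
          ∂(Measure.pi fun _ : Fin k => (volume : Measure (EuclideanSpace ℝ (Fin 2))).restrict Λ) :=
        lintegral_add_left (hind.mul (Finset.measurable_sum _ fun c _ => hJm c)) _
    _ ≤ ∫⁻ x, (Dpos ∩ {X | HardCoreIn Λ X}).indicator 1 (superpose Λ x Y)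
          ∂(Measure.pi fun _ : Fin k => (volume : Measure (EuclideanSpace ℝ (Fin 2))).restrict Λ) +
        ∫⁻ x, (Dneg ∩ {X | HardCoreIn Λ X}).indicator 1 (superpose Λ x Y)
          ∂(Measure.pi fun _ : Fin k => (volume : Measure (EuclideanSpace ℝ (Fin 2))).restrict Λ) := by
        refine add_le_add ?_ ?_
        · exact lintegral_indicator_mul_sum_le hL hΛ Y hS hDpos (C k).source (C k).targetPos
            (C k).shift (C k).order (hC k).measurable_shift (hC k).triangular (hC k).lipschitz
            (hC k).measurableSet_source (hC k).measurableSet_targetPos (hC k).disjoint_targetPos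
            (hC k).transfer_pos
        · exact lintegral_indicator_mul_sum_le hL hΛ Y hS hDneg (C k).source (C k).targetNeg
            (fun c j x => -(C k).shift c j x) (C k).order
            (fun c j => ((hC k).measurable_shift c j).neg)
            (fun c j x x' h => by rw [(hC k).triangular c j x x' h])
            (fun c j x => LipschitzWith.fun_neg_real ((hC k).lipschitz c j x))
            (hC k).measurableSet_source (hC k).measurableSet_targetNeg (hC k).disjoint_targetNeg
            (hC k).transfer_neg

end Literature.Barriers.AtomisticToContinuum.HardDisk

end
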